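import Literature.AnabelianGeometry.AbsoluteAnabelian.AbsTopII.TwoTripodNodalProp13v
import HarnessLib

/-!
# [AbsTopII] Prop 1.3 (viii) at the two-vertex nodal datum, I: conjugation-invariant retractions and the edge-pair calculus

S. Mochizuki, *Topics in Absolute Anabelian Geometry II* [AbsTopII] (bib `MochizukiAbsTopII2013`; locators =
PDF pages of the kurims manuscript `paper:url-585b8d0ad0d9`), §1 Prop 1.3 (viii) p. 12: "Let `e, e'` be edges of
`𝔾`. If `D_e ∩ D_{e'} ∩ Π_I ≠ {1}`, then either `e = e'` or `e`, `e'` are distinct, abut to the same vertex `v`, and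
`D_e ∩ D_{e'} ∩ Π_𝔾 = {1}`; moreover, in the latter situation, `I_v = D_e ∩ D_{e'} ∩ Π_I`"; Ribes–Zalesskii Thm. 9.1.12
(free factors of free pro-`Σ` groups) [cite: RibesZalesskii2010, Thm. 9.1.12].

PROOF-ONLY companion of `AbsTopII/TwoTripodNodalDatum.lean` (abc-iut-f-066 gen 6, row «P13v-TWO-VERTEX», follow-on
«P13viii-TWO-VERTEX»), part I of the (viii) files.  At `M.dpsc` (two tripods `v_A`, `v_B`, ONE non-loop node `e`, cusps
`c₁, c₂ | c₃, c₀`; `D_{c_j} = Π_{c_j}·T` (`j = 1, 2`), `Π_{c_j}·U` (`j = 3, 0`), `D_e = Π_e·T = Π_e·U`; every `Σ`) the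
intersections `D_ε ∩ γ D_{ε'} γ⁻¹`, `γ ∈ Π_𝔾`, are computed by ONE mechanism:

* `exists_retraction` — for every free basis `(b₀, b₁, b₂)` of `Γ_{0,4}` and index `j`, the continuous retraction
  `R : Π_𝔾 → Π_𝔾` onto `closure ⟨κG(b_j)⟩` (`b_j ↦ b_j`, `b_i ↦ 1`; abc-iut-L3's `freeFactor_retract_apply`, p-ids in
  `ProSigmaFreeFactorMalnormal.lean`) is **invariant under conjugation by EVERY element of `P`**: `R(s x s⁻¹) = R(x)`
  (its image is abelian, so `Π_𝔾` acts trivially; the twist generator `t₀` moves each `c_j` to a `Π_𝔾`-conjugate; the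
  invariance group is closed and `P = Π_𝔾 · T`);
* `retract_core` — if `k s = γ (k' s') γ⁻¹` (`k, k', γ, s's⁻¹ ∈ Π_𝔾`) then `R(k) = R(k') · R(s' s⁻¹)` for every such `R`;
* `inf_conj_eq_inf_centralizer` — SAME SECTION `S ∈ {T, U}` (`S ∩ Π_𝔾 = 1`, centralising `K`, `K'`): if retractions
  separating `K` from `K'` exist, then `(K·S) ∩ γ(K'·S)γ⁻¹ = S ∩ Z(γ)` for EVERY `γ ∈ Π_𝔾` (so its `Π_𝔾`-part is trivial,
  and it is all of `S` as soon as `γ` centralises `S`);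
* `inf_conj_eq_bot_of_cross` — CROSS SECTIONS: `(K·T) ∩ γ(K'·U)γ⁻¹ = 1` for every `γ ∈ Π_𝔾`, given retractions separating
  `K`, `K'`, `Π_e` (the quotient `u t⁻¹` of the two section parts lies in `(T·U) ∩ Π_𝔾 = Π_e`).
Part II (`TwoTripodNodalEdgePairs.lean`) instantiates these at the ten pairs of distinct edges and assembles the typed
`Prop_1_3_viii'`.  HONEST FRAMING: classical profinite group theory at a constructed model (constructed ≠ geometric);
nothing here bears on [IUTchIII] Cor 3.12; no side taken.
-/

noncomputable section

open scoped Pointwise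

namespace Literature.AnabelianGeometry.AbsoluteAnabelian.AbsTopII.TwoTripodNodal.Model

open Literature.AnabelianGeometry.SemiGraphs
open Literature.AnabelianGeometry.SemiGraphs.SemiGraphOfAnabelioids (IsProSigmaCompletion)
open Literature.AnabelianGeometry.SemiGraphs.SemiGraphOfAnabelioids.IsProSigmaCompletion
open Literature.AnabelianGeometry.Anabelioids (IsSigmaInteger)
open Literature.GroupTheory.CombinatorialGroupTheory
open Literature.GroupTheory.CombinatorialGroupTheory.PuncturedSurfaceGroup
open Literature.GroupTheory.CombinatorialGroupTheory.FreeFactorFibredTwist (lift_apply_basis)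
open _root_.Topology

variable {Sigma : Set ℕ} (M : Model Sigma)

/-! ### Cyclic factors of `Π_𝔾` -/

/-- The closure of the cyclic free factor `⟨b_j⟩` inside `Π_𝔾`, as the closure of `⟨κG(b_j)⟩`.
[cite: RibesZalesskii2010, Thm. 9.1.12] -/
theorem cyclicFactor_eq (b : FreeGroupBasis (Fin 3) (PuncturedSurfaceGroup 0 4)) (j : Fin 3) :
    ((Subgroup.closure (b '' ({j} : Set (Fin 3)))).map M.κG).topologicalClosure =
      (Subgroup.zpowers (M.κG (b j))).topologicalClosure := by
  rw [Set.image_singleton, ← Subgroup.zpowers_eq_closure, MonoidHom.map_zpowers]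

/-- The closure of a cyclic subgroup of `Π_𝔾` is commutative. [cite: RibesZalesskii2010, Lemma 3.2.1] -/
theorem zpowers_closure_comm (y : ↥M.PiG) : ∀ a ∈ (Subgroup.zpowers y).topologicalClosure,
    ∀ c ∈ (Subgroup.zpowers y).topologicalClosure, a * c = c * a := by
  intro a ha c hc
  letI := (Subgroup.zpowers y).commGroupTopologicalClosure (fun u v => by
    obtain ⟨u, m, rfl⟩ := u
    obtain ⟨v, n, rfl⟩ := v
    exact Subtype.ext (zpow_mul_comm y m n))
  exact congrArg Subtype.val (mul_comm (⟨a, ha⟩ : ↥(Subgroup.zpowers y).topologicalClosure) ⟨c, hc⟩)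

/-! ### Conjugation-invariant retractions -/

/-- **The continuous retraction onto a cyclic free factor is invariant under conjugation by every element of `P`.**
For a free basis `(b₀, b₁, b₂)` of `Γ_{0,4}` and an index `j` there is a continuous `R : Π_𝔾 → Π_𝔾` with: `R = id` on
`closure ⟨κG(b_j)⟩`, values in it, `R(κG(b_i)) = 1` for `i ≠ j`, and `R(s x s⁻¹) = R(x)` for ALL `s ∈ P`, `x ∈ Π_𝔾`.
[cite: RibesZalesskii2010, Thm. 9.1.12] -/
theorem exists_retraction (b : FreeGroupBasis (Fin 3) (PuncturedSurfaceGroup 0 4)) (j : Fin 3) :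
    ∃ R : ↥M.PiG →* ↥M.PiG, Continuous R ∧
      (∀ a ∈ (Subgroup.zpowers (M.κG (b j))).topologicalClosure, R a = a) ∧
      (∀ z, R z ∈ (Subgroup.zpowers (M.κG (b j))).topologicalClosure) ∧
      (∀ i, i ≠ j → R (M.κG (b i)) = 1) ∧
      ∀ (s : M.P) (x : ↥M.PiG) (hsx : s * (x : M.P) * s⁻¹ ∈ M.PiG), R ⟨s * x * s⁻¹, hsx⟩ = R x := by
  classical
  have hN : M.PiG.Normal := M.normal_PiG
  haveI : CompactSpace ↥M.PiG := isCompact_iff_compactSpace.mp M.isClosed_PiG.isCompact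
  let ρ : PuncturedSurfaceGroup 0 4 →* PuncturedSurfaceGroup 0 4 :=
    b.lift fun i => if i ∈ ({j} : Set (Fin 3)) then b i else 1
  have hρ : ∀ i, ρ (b i) = if i ∈ ({j} : Set (Fin 3)) then b i else 1 := fun i => lift_apply_basis b _ i
  obtain ⟨R, hRc, hRι'⟩ := exists_continuous_extend_profinite M.isProSigmaCompletion_κG
    M.isProSigmaCompletion_κG.index_open (M.κG.comp ρ)
  have hRι : ∀ γ, R (M.κG γ) = M.κG (ρ γ) := fun γ => hRι' γ
  obtain ⟨hRA, hRmem⟩ := freeFactor_retract_apply b ({j} : Set (Fin 3)) ρ hρ M.isProSigmaCompletion_κG _ rfl R hRc hRι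
  rw [cyclicFactor_eq] at hRA hRmem
  have hkill : ∀ i, i ≠ j → R (M.κG (b i)) = 1 := fun i hi => by
    rw [hRι, hρ, if_neg (by simpa using hi), map_one]
  -- the image of `R` is abelian
  have hcomm : ∀ x y : ↥M.PiG, R x * R y = R y * R x := fun x y =>
    M.zpowers_closure_comm _ _ (hRmem x) _ (hRmem y)
  refine ⟨R, hRc, hRA, hRmem, hkill, ?_⟩
  -- the invariance subgroup
  let Sg : Subgroup M.P :=
    { carrier := {s | ∀ x : ↥M.PiG, R ⟨s * x * s⁻¹, hN.conj_mem _ x.2 s⟩ = R x}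
      one_mem' := fun x => by
        have : (⟨1 * (x : M.P) * 1⁻¹, hN.conj_mem _ x.2 1⟩ : ↥M.PiG) = x := Subtype.ext (by simp)
        rw [this]
      mul_mem' := fun {s s'} hs hs' x => by
        have h1 : (⟨s * s' * (x : M.P) * (s * s')⁻¹, hN.conj_mem _ x.2 (s * s')⟩ : ↥M.PiG) =
            ⟨s * ((⟨s' * x * s'⁻¹, hN.conj_mem _ x.2 s'⟩ : ↥M.PiG) : M.P) * s⁻¹,
              hN.conj_mem _ (hN.conj_mem _ x.2 s') s⟩ := Subtype.ext (by simp [mul_assoc])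
        rw [h1, hs, hs']
      inv_mem' := fun {s} hs x => by
        have h := hs ⟨s⁻¹ * x * s⁻¹⁻¹, hN.conj_mem _ x.2 s⁻¹⟩
        have h1 : (⟨s * ((⟨s⁻¹ * (x : M.P) * s⁻¹⁻¹, hN.conj_mem _ x.2 s⁻¹⟩ : ↥M.PiG) : M.P) * s⁻¹,
            hN.conj_mem _ (hN.conj_mem _ x.2 s⁻¹) s⟩ : ↥M.PiG) = x := Subtype.ext (by simp [mul_assoc])
        rw [h1] at h
        exact h.symm }
  -- it is closed
  have hSc : IsClosed (Sg : Set M.P) := by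
    have : (Sg : Set M.P) = ⋂ x : ↥M.PiG, {s : M.P | R ⟨s * x * s⁻¹, hN.conj_mem _ x.2 s⟩ = R x} := by
      ext s; simp [Sg, Set.mem_iInter]
    rw [this]
    refine isClosed_iInter fun x => isClosed_eq ?_ continuous_const
    exact hRc.comp (((continuous_id.mul continuous_const).mul continuous_id.inv).subtype_mk _)
  -- it contains `Π_𝔾` (abelian image)
  have hGle : M.PiG ≤ Sg := fun g hg x => by
    have h1 : (⟨g * (x : M.P) * g⁻¹, hN.conj_mem _ x.2 g⟩ : ↥M.PiG) = ⟨g, hg⟩ * x * ⟨g, hg⟩⁻¹ := rfl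
    rw [h1, map_mul, map_mul, map_inv, hcomm (⟨g, hg⟩ : ↥M.PiG) x, mul_inv_cancel_right]
  -- it contains the twist generator `t₀`
  have ht0 : M.ι (SemidirectProduct.inr (Multiplicative.ofAdd (1 : ℤ))) ∈ Sg := by
    set t₀ := M.ι (SemidirectProduct.inr (Multiplicative.ofAdd (1 : ℤ))) with ht₀
    haveI : M.PiG.Normal := hN
    let σ : ↥M.PiG →* ↥M.PiG := (MulAut.conjNormal t₀ : MulAut ↥M.PiG).toMonoidHom
    have hσv : ∀ x : ↥M.PiG, ((σ x : ↥M.PiG) : M.P) = t₀ * x * t₀⁻¹ := fun x => MulAut.conjNormal_apply _ _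
    have hσc : Continuous σ := by
      refine continuous_induced_rng.mpr ?_
      have : (Subtype.val ∘ σ : ↥M.PiG → M.P) = fun x : ↥M.PiG => t₀ * (x : M.P) * t₀⁻¹ := funext hσv
      rw [this]
      exact (continuous_const.mul continuous_subtype_val).mul continuous_const
    obtain ⟨b₀, hb₀⟩ := exists_freeGroupBasis_succ
    have hσκ : ∀ γ, σ (M.κG γ) = M.κG (M.φ (Multiplicative.ofAdd (1 : ℤ)) γ) := fun γ =>
      Subtype.ext (by rw [hσv, coe_κG, coe_κG, ht₀, t0_conj])
    have hRσ : R.comp σ = R := by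
      refine continuous_extend_profinite_unique M.isProSigmaCompletion_κG (hRc.comp hσc) hRc fun γ => ?_
      rw [MonoidHom.comp_apply, hσκ]
      have hh : (R.comp M.κG).comp (M.φ (Multiplicative.ofAdd (1 : ℤ))).toMonoidHom = R.comp M.κG := by
        refine b₀.ext_hom _ _ fun i => ?_
        simp only [MonoidHom.comp_apply, MulEquiv.coe_toMonoidHom, hb₀]
        fin_cases i
        · show R (M.κG (M.φ _ (c 1))) = R (M.κG (c 1)); rw [M.twist_c_one]
        · show R (M.κG (M.φ _ (c 2))) = R (M.κG (c 2)); rw [M.twist_c_two]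
        · show R (M.κG (M.φ _ (c 3))) = R (M.κG (c 3))
          rw [M.twist_c_three, map_mul, map_mul, map_inv, map_mul, map_mul, map_inv, hcomm, mul_inv_cancel_right]
      exact DFunLike.congr_fun hh γ
    intro x
    have h1 : (⟨t₀ * (x : M.P) * t₀⁻¹, hN.conj_mem _ x.2 t₀⟩ : ↥M.PiG) = σ x := Subtype.ext (by rw [hσv])
    rw [h1]
    exact DFunLike.congr_fun hRσ x
  -- hence `T ≤ Sg` and `Sg = ⊤`
  have hTle : M.T ≤ Sg := by
    rw [Model.T, map_inr_range_eq_zpowers]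
    exact Subgroup.topologicalClosure_minimal _ ((Subgroup.zpowers_le).mpr ht0) hSc
  have htop : Sg = ⊤ := by
    rw [eq_top_iff, ← M.PiG_sup_T]
    exact sup_le hGle hTle
  intro s x hsx
  have hs : s ∈ Sg := htop ▸ Subgroup.mem_top s
  exact hs x

/-! ### The core computation -/

/-- **Core.**  If `k s = γ (k' s') γ⁻¹` with `k, k', γ, s' s⁻¹ ∈ Π_𝔾`, then `R(k) = R(k') · R(s' s⁻¹)` for every
conjugation-invariant endomorphism `R` of `Π_𝔾` (`k = (γ k' γ⁻¹) · (γ · s' γ⁻¹ s'⁻¹) · (s' s⁻¹)`).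
[cite: MochizukiAbsTopII2013, Prop 1.3 (viii) p.12] -/
theorem retract_core (R : ↥M.PiG →* ↥M.PiG)
    (hR : ∀ (s : M.P) (x : ↥M.PiG) (hsx : s * (x : M.P) * s⁻¹ ∈ M.PiG), R ⟨s * x * s⁻¹, hsx⟩ = R x)
    {k k' γ s s' : M.P} (hk : k ∈ M.PiG) (hk' : k' ∈ M.PiG) (hγ : γ ∈ M.PiG) (hss : s' * s⁻¹ ∈ M.PiG)
    (hx : k * s = γ * (k' * s') * γ⁻¹) :
    R ⟨k, hk⟩ = R ⟨k', hk'⟩ * R ⟨s' * s⁻¹, hss⟩ := by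
  have hN : M.PiG.Normal := M.normal_PiG
  have h1 : γ * k' * γ⁻¹ ∈ M.PiG := hN.conj_mem _ hk' γ
  have h2 : s' * γ⁻¹ * s'⁻¹ ∈ M.PiG := hN.conj_mem _ (M.PiG.inv_mem hγ) s'
  have hkeq : k = (γ * k' * γ⁻¹) * (γ * (s' * γ⁻¹ * s'⁻¹)) * (s' * s⁻¹) := by
    have : k = γ * (k' * s') * γ⁻¹ * s⁻¹ := by rw [← hx, mul_inv_cancel_right]
    rw [this]; group
  have hk1 : (⟨k, hk⟩ : ↥M.PiG) = ⟨γ * k' * γ⁻¹, h1⟩ * (⟨γ, hγ⟩ * ⟨s' * γ⁻¹ * s'⁻¹, h2⟩) * ⟨s' * s⁻¹, hss⟩ :=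
    Subtype.ext (by simpa [mul_assoc] using hkeq)
  have h3 : (⟨s' * γ⁻¹ * s'⁻¹, h2⟩ : ↥M.PiG) = ⟨s' * ((⟨γ, hγ⟩ : ↥M.PiG)⁻¹ : ↥M.PiG) * s'⁻¹,
      hN.conj_mem _ (M.PiG.inv_mem hγ) s'⟩ := rfl
  rw [hk1, map_mul, map_mul, map_mul, hR γ ⟨k', hk'⟩ h1, h3, hR s' _ _, map_inv, mul_inv_cancel, mul_one]

/-! ### Decomposing elements of `K · S` -/

/-- An element of `K ⊔ S` with `S` centralising `K` is a product `k · s`. [cite: MochizukiAbsTopII2013, Prop 1.3 (vii) p.12] -/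
theorem exists_mul_of_mem_sup {K S : Subgroup M.P} (hSK : S ≤ Subgroup.centralizer (K : Set M.P)) {x : M.P}
    (hx : x ∈ K ⊔ S) : ∃ k ∈ K, ∃ s ∈ S, x = k * s := by
  have hle : K ≤ Subgroup.normalizer (S : Set M.P) :=
    le_trans (Subgroup.le_centralizer_iff.mp hSK) (Subgroup.centralizer_le_normalizer _)
  have hx' : x ∈ ((K ⊔ S : Subgroup M.P) : Set M.P) := hx
  rw [Subgroup.coe_mul_of_left_le_normalizer_right K S hle] at hx'
  obtain ⟨k, hk, s, hs, rfl⟩ := Set.mem_mul.mp hx'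
  exact ⟨k, hk, s, hs, rfl⟩

/-- The quotient of the two section parts lies in `Π_𝔾`: if `k s = γ (k' s') γ⁻¹` with `k, k', γ ∈ Π_𝔾` then
`s' s⁻¹ ∈ Π_𝔾`. [cite: MochizukiAbsTopII2013, Prop 1.3 (viii) p.12] -/
theorem section_quotient_mem {k k' γ s s' : M.P} (hk : k ∈ M.PiG) (hk' : k' ∈ M.PiG) (hγ : γ ∈ M.PiG)
    (hx : k * s = γ * (k' * s') * γ⁻¹) : s' * s⁻¹ ∈ M.PiG := by
  have hN : M.PiG.Normal := M.normal_PiG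
  have h : s' * s⁻¹ = (s' * γ * s'⁻¹) * k'⁻¹ * γ⁻¹ * k := by
    have hs : s = k⁻¹ * (γ * (k' * s') * γ⁻¹) := by rw [← hx, inv_mul_cancel_left]
    rw [hs]; group
  rw [h]
  exact M.PiG.mul_mem (M.PiG.mul_mem (M.PiG.mul_mem (hN.conj_mem _ hγ s') (M.PiG.inv_mem hk'))
    (M.PiG.inv_mem hγ)) hk

/-! ### Same section: `(K·S) ∩ γ(K'·S)γ⁻¹ = S ∩ Z(γ)` -/

/-- **Same-section edge pairs.**  Let `S` be a section (`S ∩ Π_𝔾 = 1`) centralising `K, K' ⊆ Π_𝔾`, and suppose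
conjugation-invariant endomorphisms `R`, `R'` of `Π_𝔾` separate them (`R` fixes `K` and kills `K'`, `R'` the other way
round).  Then for EVERY `γ ∈ Π_𝔾`: `(K·S) ∩ γ (K'·S) γ⁻¹ = S ∩ Z(γ)` — an element `k s = γ k' s γ⁻¹` has `k = k' = 1`
by `retract_core`. [cite: MochizukiAbsTopII2013, Prop 1.3 (viii) p.12] -/
theorem inf_conj_eq_inf_centralizer (K₀ K₀' : Subgroup ↥M.PiG) (S : Subgroup M.P) (hSbot : S ⊓ M.PiG = ⊥)
    (hSK : S ≤ Subgroup.centralizer ((K₀.map M.PiG.subtype : Subgroup M.P) : Set M.P))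
    (hSK' : S ≤ Subgroup.centralizer ((K₀'.map M.PiG.subtype : Subgroup M.P) : Set M.P))
    (R R' : ↥M.PiG →* ↥M.PiG)
    (hR : ∀ (s : M.P) (x : ↥M.PiG) (hsx : s * (x : M.P) * s⁻¹ ∈ M.PiG), R ⟨s * x * s⁻¹, hsx⟩ = R x)
    (hRK : ∀ a ∈ K₀, R a = a) (hRK' : ∀ a ∈ K₀', R a = 1)
    (hR' : ∀ (s : M.P) (x : ↥M.PiG) (hsx : s * (x : M.P) * s⁻¹ ∈ M.PiG), R' ⟨s * x * s⁻¹, hsx⟩ = R' x)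
    (hR'K' : ∀ a ∈ K₀', R' a = a) (hR'K : ∀ a ∈ K₀, R' a = 1)
    {γ : M.P} (hγ : γ ∈ M.PiG) :
    (K₀.map M.PiG.subtype ⊔ S) ⊓ MulAut.conj γ • (K₀'.map M.PiG.subtype ⊔ S) =
      S ⊓ Subgroup.centralizer ({γ} : Set M.P) := by
  ext x
  constructor
  · intro hx0
    obtain ⟨hx1, hx2⟩ := Subgroup.mem_inf.mp hx0
    obtain ⟨k, hk, s, hs, rfl⟩ := M.exists_mul_of_mem_sup hSK hx1
    obtain ⟨y, hy, hyx⟩ := (Subgroup.mem_smul_pointwise_iff_exists _ _ _).mp hx2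
    obtain ⟨k', hk', s', hs', rfl⟩ := M.exists_mul_of_mem_sup hSK' hy
    rw [MulAut.smul_def, MulAut.conj_apply] at hyx
    obtain ⟨⟨k₀, hk₀G⟩, hk₀, rfl⟩ := hk
    obtain ⟨⟨k₀', hk₀'G⟩, hk₀', rfl⟩ := hk'
    have hx : k₀ * s = γ * (k₀' * s') * γ⁻¹ := hyx.symm
    have hss := M.section_quotient_mem hk₀G hk₀'G hγ hx
    -- `s' = s`
    have hs's : s' * s⁻¹ = 1 := by
      rw [← Subgroup.mem_bot, ← hSbot]; exact ⟨S.mul_mem hs' (S.inv_mem hs), hss⟩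
    have hs'eq : s' = s := mul_inv_eq_one.mp hs's
    have hone : (⟨s' * s⁻¹, hss⟩ : ↥M.PiG) = 1 := Subtype.ext hs's
    -- `k = 1` and `k' = 1`
    have h1 := M.retract_core R hR hk₀G hk₀'G hγ hss hx
    rw [hRK _ hk₀, hRK' _ hk₀', hone, map_one, one_mul] at h1
    have hk1 : k₀ = 1 := congrArg Subtype.val h1
    have hx' : k₀' * s' = γ⁻¹ * (k₀ * s) * γ⁻¹⁻¹ := by rw [hx]; group
    have hss2 := M.section_quotient_mem hk₀'G hk₀G (M.PiG.inv_mem hγ) hx'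
    have hss1 : s * s'⁻¹ = 1 := by rw [hs'eq]; exact mul_inv_cancel s
    have hone2 : (⟨s * s'⁻¹, hss2⟩ : ↥M.PiG) = 1 := Subtype.ext hss1
    have h2 := M.retract_core R' hR' hk₀'G hk₀G (M.PiG.inv_mem hγ) hss2 hx'
    rw [hR'K' _ hk₀', hR'K _ hk₀, hone2, map_one, one_mul] at h2
    have hk1' : k₀' = 1 := congrArg Subtype.val h2
    have h : γ * s * γ⁻¹ = s := by
      have h0 : γ * (k₀' * s') * γ⁻¹ = k₀ * s := hx.symm
      rwa [hk1', hs'eq, one_mul, hk1, one_mul] at h0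
    refine Subgroup.mem_inf.mpr ⟨?_, ?_⟩
    · show k₀ * s ∈ S
      rw [hk1, one_mul]; exact hs
    · show k₀ * s ∈ Subgroup.centralizer ({γ} : Set M.P)
      rw [Subgroup.mem_centralizer_singleton_iff, hk1, one_mul]
      calc s * γ = γ * s * γ⁻¹ * γ := by rw [h]
        _ = γ * s := by rw [inv_mul_cancel_right]
  · intro hx0
    obtain ⟨hxS, hxγ⟩ := Subgroup.mem_inf.mp hx0
    rw [Subgroup.mem_centralizer_singleton_iff] at hxγ
    refine Subgroup.mem_inf.mpr ⟨Subgroup.mem_sup_right hxS, ?_⟩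
    refine (Subgroup.mem_smul_pointwise_iff_exists _ _ _).mpr ⟨x, Subgroup.mem_sup_right hxS, ?_⟩
    rw [MulAut.smul_def, MulAut.conj_apply]
    exact mul_inv_eq_iff_eq_mul.mpr hxγ.symm

/-! ### Cross sections: `(K·T) ∩ γ(K'·U)γ⁻¹ = 1` -/

/-- `W := ι(Π_e)` and `U` commute. [cite: MochizukiAbsTopII2013, Prop 1.3 (ii) p.11] -/
theorem W_commute_U : ∀ a ∈ (M.nodeGp).map M.PiG.subtype, ∀ u ∈ M.U, a * u = u * a := by
  intro a ha u hu
  have hle : (M.nodeGp).map M.PiG.subtype ≤ (M.vertGpB).map M.PiG.subtype :=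
    Subgroup.map_mono (Subgroup.topologicalClosure_mono (Subgroup.map_mono
      ((Subgroup.zpowers_le (g := (c 1 * c 2 : PuncturedSurfaceGroup 0 4))).mpr node_mem_closureB)))
  exact Subgroup.mem_centralizer_iff.mp (M.U_le_centralizer_vertGpB hu) a (hle ha)

/-- `T ⊔ U = W ⊔ U` (both equal `I_e = W·T`). [cite: MochizukiAbsTopII2013, Prop 1.3 (ii) p.11] -/
theorem T_sup_U_eq_WU : M.T ⊔ M.U = (M.nodeGp).map M.PiG.subtype ⊔ M.U := by
  apply le_antisymm
  · refine sup_le ?_ le_sup_right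
    rw [Model.T, map_inr_range_eq_zpowers]
    refine Subgroup.topologicalClosure_minimal _ ((Subgroup.zpowers_le).mpr ?_)
      (M.isClosed_sup_of_commute M.isClosed_W (Subgroup.isClosed_topologicalClosure _) M.W_commute_U).2
    have hnode : M.ι (SemidirectProduct.inl (c 1 * c 2 : PuncturedSurfaceGroup 0 4)) ∈ (M.nodeGp).map M.PiG.subtype := by
      rw [nodeGp_map_eq]; exact Subgroup.le_topologicalClosure _ (Subgroup.mem_zpowers _)
    have h : M.ι (SemidirectProduct.inr (Multiplicative.ofAdd (1 : ℤ))) =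
        M.ι (SemidirectProduct.inl (c 1 * c 2 : PuncturedSurfaceGroup 0 4)) *
          M.ι (SemidirectProduct.inl (c 1 * c 2 : PuncturedSurfaceGroup 0 4)⁻¹ *
            SemidirectProduct.inr (Multiplicative.ofAdd (1 : ℤ))) := by
      rw [← map_mul, map_inv, mul_inv_cancel_left]
    rw [h]
    exact Subgroup.mul_mem _ (Subgroup.mem_sup_left hnode) (Subgroup.mem_sup_right M.u0_mem_U)
  · rw [M.T_sup_U_eq_WT]
    exact sup_le le_sup_left (M.T_sup_U_eq_WT ▸ le_sup_right)

/-- `(T ⊔ U) ∩ Π_𝔾 = W`. [cite: MochizukiAbsTopII2013, Prop 1.3 (ii) p.11] -/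
theorem TU_inf_PiG : (M.T ⊔ M.U) ⊓ M.PiG = (M.nodeGp).map M.PiG.subtype := by
  rw [M.T_sup_U_eq_WT]
  exact M.sup_inf_PiG_eq_of_section _ _ (Subgroup.map_subtype_le _)
    (fun t ht => Subgroup.mem_centralizer_iff.mpr fun a ha => M.W_commute_T a ha t ht) M.T_inf_PiG

/-- `T ∩ U = {1}`. [cite: MochizukiAbsTopII2013, Prop 1.3 (iv) p.11] -/
theorem T_inf_U : M.T ⊓ M.U = ⊥ := by
  have h := (M.T_inf_conj_U 1).1
  rwa [map_one, one_smul] at h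

/-- **Cross-section edge pairs.**  With `K` centralised by `T`, `K'` centralised by `U` (`K, K' ⊆ Π_𝔾`) and
conjugation-invariant endomorphisms `R₁` (fixes `K`, kills `K'` and `Π_e`), `R₂` (fixes `K'`, kills `K` and `Π_e`),
`R₃` (fixes `Π_e`): `(K·T) ∩ γ(K'·U)γ⁻¹ = 1` for every `γ ∈ Π_𝔾` (the section quotient `u t⁻¹` lies in
`(T·U) ∩ Π_𝔾 = Π_e`; three applications of `retract_core`). [cite: MochizukiAbsTopII2013, Prop 1.3 (viii) p.12] -/
theorem inf_conj_eq_bot_of_cross (K₀ K₀' : Subgroup ↥M.PiG)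
    (hTK : M.T ≤ Subgroup.centralizer ((K₀.map M.PiG.subtype : Subgroup M.P) : Set M.P))
    (hUK' : M.U ≤ Subgroup.centralizer ((K₀'.map M.PiG.subtype : Subgroup M.P) : Set M.P))
    (R₁ R₂ R₃ : ↥M.PiG →* ↥M.PiG)
    (hR₁ : ∀ (s : M.P) (x : ↥M.PiG) (hsx : s * (x : M.P) * s⁻¹ ∈ M.PiG), R₁ ⟨s * x * s⁻¹, hsx⟩ = R₁ x)
    (hR₁K : ∀ a ∈ K₀, R₁ a = a) (hR₁K' : ∀ a ∈ K₀', R₁ a = 1) (hR₁W : ∀ a ∈ M.nodeGp, R₁ a = 1)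
    (hR₂ : ∀ (s : M.P) (x : ↥M.PiG) (hsx : s * (x : M.P) * s⁻¹ ∈ M.PiG), R₂ ⟨s * x * s⁻¹, hsx⟩ = R₂ x)
    (hR₂K' : ∀ a ∈ K₀', R₂ a = a) (hR₂K : ∀ a ∈ K₀, R₂ a = 1) (hR₂W : ∀ a ∈ M.nodeGp, R₂ a = 1)
    (hR₃ : ∀ (s : M.P) (x : ↥M.PiG) (hsx : s * (x : M.P) * s⁻¹ ∈ M.PiG), R₃ ⟨s * x * s⁻¹, hsx⟩ = R₃ x)
    (hR₃W : ∀ a ∈ M.nodeGp, R₃ a = a)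
    {γ : M.P} (hγ : γ ∈ M.PiG) :
    (K₀.map M.PiG.subtype ⊔ M.T) ⊓ MulAut.conj γ • (K₀'.map M.PiG.subtype ⊔ M.U) = ⊥ := by
  rw [eq_bot_iff]
  intro x hx0
  obtain ⟨hx1, hx2⟩ := Subgroup.mem_inf.mp hx0
  rw [Subgroup.mem_bot]
  obtain ⟨k, hk, t, ht, rfl⟩ := M.exists_mul_of_mem_sup hTK hx1
  obtain ⟨y, hy, hyx⟩ := (Subgroup.mem_smul_pointwise_iff_exists _ _ _).mp hx2
  obtain ⟨k', hk', u, hu, rfl⟩ := M.exists_mul_of_mem_sup hUK' hy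
  rw [MulAut.smul_def, MulAut.conj_apply] at hyx
  obtain ⟨⟨k₀, hk₀G⟩, hk₀, rfl⟩ := hk
  obtain ⟨⟨k₀', hk₀'G⟩, hk₀', rfl⟩ := hk'
  have hx : k₀ * t = γ * (k₀' * u) * γ⁻¹ := hyx.symm
  have hss := M.section_quotient_mem hk₀G hk₀'G hγ hx
  -- `u t⁻¹ ∈ (T ⊔ U) ∩ Π_𝔾 = W`
  have hωW : (⟨u * t⁻¹, hss⟩ : ↥M.PiG) ∈ M.nodeGp := by
    have h : u * t⁻¹ ∈ (M.T ⊔ M.U) ⊓ M.PiG :=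
      ⟨Subgroup.mul_mem _ (Subgroup.mem_sup_right hu) (Subgroup.inv_mem _ (Subgroup.mem_sup_left ht)), hss⟩
    rw [TU_inf_PiG] at h
    obtain ⟨z, hz, hzv⟩ := h
    have : z = ⟨u * t⁻¹, hss⟩ := Subtype.ext hzv
    exact this ▸ hz
  -- `k = 1`
  have h1 := M.retract_core R₁ hR₁ hk₀G hk₀'G hγ hss hx
  rw [hR₁K _ hk₀, hR₁K' _ hk₀', hR₁W _ hωW, mul_one] at h1
  -- `k' = 1`
  have hx' : k₀' * u = γ⁻¹ * (k₀ * t) * γ⁻¹⁻¹ := by rw [hx]; group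
  have hss2 := M.section_quotient_mem hk₀'G hk₀G (M.PiG.inv_mem hγ) hx'
  have hωW2 : (⟨t * u⁻¹, hss2⟩ : ↥M.PiG) ∈ M.nodeGp := by
    have : (⟨t * u⁻¹, hss2⟩ : ↥M.PiG) = (⟨u * t⁻¹, hss⟩ : ↥M.PiG)⁻¹ := Subtype.ext (by simp)
    rw [this]; exact M.nodeGp.inv_mem hωW
  have h2 := M.retract_core R₂ hR₂ hk₀'G hk₀G (M.PiG.inv_mem hγ) hss2 hx'
  rw [hR₂K' _ hk₀', hR₂K _ hk₀, hR₂W _ hωW2, mul_one] at h2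
  -- `u t⁻¹ = 1`
  have h3 := M.retract_core R₃ hR₃ hk₀G hk₀'G hγ hss hx
  rw [h1, h2, map_one, hR₃W _ hωW, one_mul] at h3
  have hut : u * t⁻¹ = 1 := (congrArg Subtype.val h3).symm
  have hu' : u = t := mul_inv_eq_one.mp hut
  have ht1 : t = 1 := by
    rw [← Subgroup.mem_bot, ← M.T_inf_U]; exact ⟨ht, hu' ▸ hu⟩
  have hk1 : k₀ = 1 := by simpa using congrArg Subtype.val h1
  change k₀ * t = 1
  rw [hk1, ht1, one_mul]

end Literature.AnabelianGeometry.AbsoluteAnabelian.AbsTopII.TwoTripodNodal.Model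

end
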